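import Literature.NumberTheory.DiophantineGeometry.AbcValuationProduct
import Literature.NumberTheory.EllipticCurves.PastenValuationProductTamagawaProofs
import Literature.NumberTheory.EllipticCurves.DegreeConjectureAbcMurtyProofs
import Literature.NumberTheory.EllipticCurves.SzpiroFreyConductorProofs
import HarnessLib

/-!
# Polynomial exponent product on Frey curves from Pasten's product theorem
(stub `stub_exponentProductFreyOfPasten` of line `two-adic-redei-depth`, crux `XiBound`,
stmt-ABC-11336)

From the tree's named fact `Literature.NumberTheory.DiophantineGeometry.pasten2024_thm_2_5`
(Pasten, *Shimura curves and the abc conjecture*, J. Number Theory 254 (2024), Thm 16.8: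
`∏_{p ∣ abc} v_p(abc) ≤ κ_ε rad(abc)^{8/3+ε}` for abc triples), taken as a hypothesis:
there are absolute `A, C` (`A = 6`) with `∏_{p ∣ N} ord_p Δ_min(E_(a,b)) ≤ C · N^A` for every
Frey–Hellegouarch curve `E_(a,b) : y² = x(x − a)(x + b)` (`a, b` coprime, `ab(a+b) ≠ 0`,
`N` its conductor).

Proof.
* `valuation_Δ_le_exp_neg_ordMinimalDiscriminant`: for any Weierstrass equation `W / K` integral
  at `v` (Dedekind `A`, `K = Frac A`), `ord_v(Δ_min) ≤ ord_v(Δ(W))` — the defining minimality of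
  the chosen local minimal model `C • W_{K_v}` tested against the integral equation
  `W_{K_v} = C⁻¹ • (C • W_{K_v})` (Silverman, AEC VII.1); over `ℤ`:
  `p^{ord_p Δ_min} ∣ Δ(W₀)` (`pow_ordMinimalDiscriminant_dvd_Δ_int`).
* The Frey model `freyIntModel a b` is a `ℤ`-model with `Δ = 16 (ab(a+b))²`, so
  `ord_p Δ_min ≤ 4·[p = 2] + 2 v_p(ab(a+b))` at every prime; the primes of `N` are those of
  `Δ_min` (`primeFactors_conductorNorm_eq`), hence divide `ab(a+b)` (`2 ∣ ab(a+b)` always), and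
  `∏_{p ∣ N} ord_p Δ_min ≤ 8^{ω(N)} ∏_{p ∣ ab(a+b)} v_p(ab(a+b)) ≤ N³ · ∏_{p ∣ ab(a+b)} v_p(ab(a+b))`.
* Rearranging signs, `{|a|, |b|, |a+b|}` is an abc triple with product `|ab(a+b)|`; Pasten with
  `ε = 1/3` gives `∏ v_p ≤ κ rad|ab(a+b)|³ ≤ κ (2N)³`
  (`radical_natAbs_dvd_two_mul_conductorNorm_freyCurve`). Total: `≤ 8κ N⁶`.
-/

-- `Summit.<Summit>.<Problem>`: for the single-conjunct summit `ABC` the duplicate `ABC.ABC` is mandated.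
set_option linter.dupNamespace false

noncomputable section

namespace Summit.ABC.ABC.Theorems

namespace XiBoundExponentProduct

open IsDedekindDomain WeierstrassCurve Rat.HeightOneSpectrum UniqueFactorizationMonoid
open Literature.NumberTheory.EllipticCurves Literature.NumberTheory.DiophantineGeometry

/-! ### `ord_v(Δ_min) ≤ ord_v(Δ)` for an integral equation -/

/-- **Minimality, the inequality.** For a Weierstrass equation `W / K` integral at `v` with
`Δ ≠ 0`, `v(Δ(W)) ≤ exp(−ord_v(Δ_min))`, i.e. `ord_v(Δ_min) ≤ ord_v(Δ(W))`: the chosen local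
minimal model `M = C • W_{K_v}` is minimal and `W_{K_v} = C⁻¹ • M` is integral, so
`v(Δ(W_{K_v})) ≤ v(Δ(M))` (Silverman, AEC VII.1, definition of a minimal equation). Only
`Δ ≠ 0` is assumed (cf. `valuation_Δ_le_of_isIntegralAt` in the sibling file
`DefiniteXiXiStrongBoundAllTamExp`, stated with `[W.IsElliptic]`). [folklore] -/
theorem valuation_Δ_le_exp_neg_ordMinimalDiscriminant {A : Type*} [CommRing A] [IsDedekindDomain A]
    {K : Type*} [Field K] [Algebra A K] [IsFractionRing A K] (v : HeightOneSpectrum A)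
    (W : WeierstrassCurve K) (hW : W.IsIntegralAt v) (hΔ : W.Δ ≠ 0) :
    v.valuation K W.Δ ≤ WithZero.exp (-(W.ordMinimalDiscriminant v : ℤ)) := by
  set Ov := v.adicCompletionIntegers K
  set Kv := v.adicCompletion K
  set X := W.baseChange Kv with hX
  set C : VariableChange Kv := (X.exists_isMinimal Ov).choose
  have hM : W.localMinimalModel v = C • X := rfl
  have hmin : (W.localMinimalModel v).IsMinimal Ov := inferInstance
  have hXC : C⁻¹ • W.localMinimalModel v = X := by rw [hM, inv_smul_smul]
  have hXint : (C⁻¹ • W.localMinimalModel v).IsIntegral Ov := by rw [hXC]; exact hW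
  have key := ((isMinimal_iff_of_le_one_iff
    (valued_le_one_iff_mem_range_adicCompletionIntegers v) _).mp hmin).2 C⁻¹ hXint
  rw [hXC] at key
  -- the discriminant of the integral local minimal model
  have hMΔ : algebraMap Ov Kv (W.localMinimalIntegralModel v).Δ = (W.localMinimalModel v).Δ :=
    integralModel_Δ_eq Ov _
  have hXΔ : X.Δ = algebraMap K Kv W.Δ := by rw [hX, baseChange, map_Δ]
  have hXΔ0 : X.Δ ≠ 0 := by rw [hXΔ]; exact (map_ne_zero _).mpr hΔ
  have hMΔ0 : (W.localMinimalModel v).Δ ≠ 0 := by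
    rw [hM, variableChange_Δ]
    exact mul_ne_zero (pow_ne_zero _ (Units.ne_zero _)) hXΔ0
  have hd0 : (W.localMinimalIntegralModel v).Δ ≠ 0 := by
    intro h
    rw [h, map_zero] at hMΔ
    exact hMΔ0 hMΔ.symm
  obtain ⟨n, hn, hvn⟩ :=
    HeightOneSpectrum.exists_addVal_adicCompletionIntegers_eq K v _ hd0
  have hvM : Valued.v (W.localMinimalModel v).Δ = WithZero.exp (-(n : ℤ)) := by
    rw [← hMΔ]; exact hvn
  rw [WeierstrassCurve.ordMinimalDiscriminant, hn, ENat.toNat_coe, ← hvM,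
    ← valued_algebraMap_adicCompletion v W.Δ, ← hXΔ]
  exact key

/-- Over `ℤ ⊆ ℚ`: for an integral equation `W₀ / ℤ` with `Δ ≠ 0` and every prime `p` (the one
below `v`), `p ^ ord_p(Δ_min) ∣ Δ(W₀)`. [folklore] -/
theorem pow_ordMinimalDiscriminant_dvd_Δ_int (v : HeightOneSpectrum ℤ) (W₀ : WeierstrassCurve ℤ)
    (hΔ : W₀.Δ ≠ 0) :
    (natGenerator v : ℤ) ^ (W₀.baseChange ℚ).ordMinimalDiscriminant v ∣ W₀.Δ := by
  have h := valuation_Δ_le_exp_neg_ordMinimalDiscriminant v (W₀.baseChange ℚ)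
    (isIntegralAt_baseChange_int v W₀) (by rw [baseChange_int_Δ]; exact_mod_cast hΔ)
  rw [baseChange_int_Δ] at h
  exact (Literature.NumberTheory.EllipticCurves.Rat.valuation_intCast_le_exp_iff v _ _).mp h

/-- Over `ℤ ⊆ ℚ`: `v_p(|Δ_min|) ≤ v_p(|Δ(W₀)|)` for an integral equation `W₀ / ℤ` with `Δ ≠ 0`
and a prime `p`. [folklore] -/
theorem factorization_minimalDiscriminantNorm_le_int (W₀ : WeierstrassCurve ℤ) (hΔ : W₀.Δ ≠ 0)
    {p : ℕ} (hp : p.Prime) :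
    ((W₀.baseChange ℚ).minimalDiscriminantNorm ℤ).factorization p ≤
      W₀.Δ.natAbs.factorization p := by
  obtain ⟨v, hv⟩ := exists_place ⟨p, hp⟩
  simp only at hv
  have hfac := factorization_minimalDiscriminantNorm_holds (W₀.baseChange ℚ) v
  have hdvd := pow_ordMinimalDiscriminant_dvd_Δ_int v W₀ hΔ
  rw [hv] at hfac hdvd
  rw [hfac]
  have hdvd' : p ^ (W₀.baseChange ℚ).ordMinimalDiscriminant v ∣ W₀.Δ.natAbs := by
    have h := Int.natAbs_dvd_natAbs.mpr hdvd
    rwa [Int.natAbs_pow, Int.natAbs_natCast] at h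
  exact (hp.pow_dvd_iff_le_factorization (Int.natAbs_ne_zero.mpr hΔ)).mp hdvd'

/-! ### The Frey curve: `v_p(Δ_min) ≤ 4·[p = 2] + 2 v_p(ab(a+b))` at every prime -/

/-- For the Frey curve `E_(a,b) = freyIntModel a b ⊗ ℚ` (`Δ = 16 (ab(a+b))²`) with `ab(a+b) ≠ 0`
and every prime `p`: `v_p(Δ_min) ≤ v_p(16 (ab(a+b))²) = 4·[p = 2] + 2 v_p(|ab(a+b)|)`. [folklore] -/
theorem factorization_minimalDiscriminantNorm_freyCurve_le_ite {a b : ℤ}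
    (h0 : a * b * (a + b) ≠ 0) {p : ℕ} (hp : p.Prime) :
    ((freyCurve a b).minimalDiscriminantNorm ℤ).factorization p ≤
      4 * (if 2 = p then 1 else 0) + 2 * (a * b * (a + b)).natAbs.factorization p := by
  have hΔ : (freyIntModel a b).Δ ≠ 0 := by
    rw [freyIntModel_Δ]; exact mul_ne_zero (by norm_num) (pow_ne_zero 2 h0)
  have h := factorization_minimalDiscriminantNorm_le_int (freyIntModel a b) hΔ hp
  rw [baseChange_freyIntModel, freyIntModel_Δ, Int.natAbs_mul, Int.natAbs_pow] at h
  have hm0 : (a * b * (a + b)).natAbs ≠ 0 := Int.natAbs_ne_zero.mpr h0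
  rwa [show (16 : ℤ).natAbs = 2 ^ 4 by norm_num,
    Nat.factorization_mul (by positivity) (pow_ne_zero 2 hm0), Finsupp.add_apply,
    Nat.factorization_pow, Nat.factorization_pow, Finsupp.smul_apply, Finsupp.smul_apply,
    smul_eq_mul, smul_eq_mul, Nat.prime_two.factorization, Finsupp.single_apply] at h

/-- For the Frey curve with `ab(a+b) ≠ 0` and every ODD prime `p`:
`v_p(Δ_min) ≤ 2 v_p(|ab(a+b)|)` (no coprimality needed; cf. the tree's
`DefiniteXiPolyFreyDegree.factorization_minimalDiscriminantNorm_freyCurve_le`). [folklore] -/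
theorem factorization_minimalDiscriminantNorm_freyCurve_le_two_mul {a b : ℤ}
    (h0 : a * b * (a + b) ≠ 0) {p : ℕ} (hp : p.Prime) (hp2 : p ≠ 2) :
    ((freyCurve a b).minimalDiscriminantNorm ℤ).factorization p ≤
      2 * (a * b * (a + b)).natAbs.factorization p := by
  have h := factorization_minimalDiscriminantNorm_freyCurve_le_ite h0 hp
  rwa [if_neg (Ne.symm hp2), mul_zero, zero_add] at h

/-- `2 ∣ ab(a+b)` for all integers `a, b`. [folklore] -/
theorem two_dvd_mul_mul_add (a b : ℤ) : (2 : ℤ) ∣ a * b * (a + b) := by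
  rcases Int.even_or_odd a with ha | ha
  · exact even_iff_two_dvd.mp ((ha.mul_right b).mul_right (a + b))
  rcases Int.even_or_odd b with hb | hb
  · exact even_iff_two_dvd.mp ((hb.mul_left a).mul_right (a + b))
  · exact even_iff_two_dvd.mp ((ha.add_odd hb).mul_left (a * b))

/-- For any integers `a, b` with `ab(a+b) ≠ 0` (no coprimality needed), the primes of the
conductor of `E_(a,b)` divide `ab(a+b)`: they are the primes of `Δ_min`
(`primeFactors_conductorNorm_eq`), `p^{v_p(Δ_min)} ∣ 16 (ab(a+b))²`, and `2 ∣ ab(a+b)`.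
[folklore] -/
theorem primeFactors_conductorNorm_freyCurve_subset {a b : ℤ} (h0 : a * b * (a + b) ≠ 0) :
    ((freyCurve a b).conductorNorm ℤ).primeFactors ⊆ (a * b * (a + b)).natAbs.primeFactors := by
  haveI := isElliptic_freyCurve h0
  intro p hp
  rw [primeFactors_conductorNorm_eq (freyCurve a b)] at hp
  have hp' : p.Prime := Nat.prime_of_mem_primeFactors hp
  have hm0 : (a * b * (a + b)).natAbs ≠ 0 := Int.natAbs_ne_zero.mpr h0
  have h1 : 1 ≤ ((freyCurve a b).minimalDiscriminantNorm ℤ).factorization p := by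
    rw [Nat.succ_le_iff, pos_iff_ne_zero, ← Finsupp.mem_support_iff, Nat.support_factorization]
    exact hp
  refine Nat.mem_primeFactors.mpr ⟨hp', ?_, hm0⟩
  by_cases hp2 : p = 2
  · subst hp2
    exact Int.ofNat_dvd_left.mp (two_dvd_mul_mul_add a b)
  · -- odd `p`: `1 ≤ v_p(Δ_min) ≤ 2 v_p(|ab(a+b)|)` forces `v_p(|ab(a+b)|) ≥ 1`
    have h3 := factorization_minimalDiscriminantNorm_freyCurve_le_two_mul h0 hp' hp2
    exact (hp'.dvd_iff_one_le_factorization hm0).mpr (by omega)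

/-! ### Elementary bookkeeping -/

/-- `8 ^ ω(N) ≤ N ^ 3` for `N ≠ 0` (`2 ^ ω(N) ≤ ∏_{p ∣ N} p ≤ N`). [folklore] -/
theorem eight_pow_card_primeFactors_le {N : ℕ} (hN : N ≠ 0) :
    8 ^ N.primeFactors.card ≤ N ^ 3 := by
  have h2 : 2 ^ N.primeFactors.card ≤ N :=
    calc 2 ^ N.primeFactors.card = ∏ _q ∈ N.primeFactors, 2 := (Finset.prod_const 2).symm
      _ ≤ ∏ q ∈ N.primeFactors, q :=
          Finset.prod_le_prod (fun _ _ => Nat.zero_le _) fun q hq =>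
            (Nat.prime_of_mem_primeFactors hq).two_le
      _ ≤ N := Nat.le_of_dvd (Nat.pos_of_ne_zero hN) (Nat.prod_primeFactors_dvd N)
  rw [show (8 : ℕ) = 2 ^ 3 by norm_num, ← pow_mul, mul_comm, pow_mul]
  exact Nat.pow_le_pow_left h2 3

/-- **The combinatorial core.** For `ab(a+b) ≠ 0` and `N` the conductor of `E_(a,b)`:
`∏_{p ∣ N} v_p(Δ_min) ≤ 8^{ω(N)} · ∏_{p ∣ ab(a+b)} v_p(ab(a+b))`
(`v_p(Δ_min) ≤ 4 + 2 v_p ≤ 8 v_p` at `p ∣ N`, since then `p ∣ ab(a+b)`). [folklore] -/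
theorem prod_factorization_minimalDiscriminantNorm_freyCurve_le {a b : ℤ}
    (h0 : a * b * (a + b) ≠ 0) :
    ∏ p ∈ ((freyCurve a b).conductorNorm ℤ).primeFactors,
        ((freyCurve a b).minimalDiscriminantNorm ℤ).factorization p ≤
      8 ^ ((freyCurve a b).conductorNorm ℤ).primeFactors.card *
        exponentProduct (a * b * (a + b)).natAbs := by
  set m := (a * b * (a + b)).natAbs with hm
  set N := (freyCurve a b).conductorNorm ℤ with hN
  have hsub := primeFactors_conductorNorm_freyCurve_subset h0
  have hvm : ∀ p ∈ m.primeFactors, 1 ≤ m.factorization p := fun p hp => by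
    rw [Nat.succ_le_iff, pos_iff_ne_zero, ← Finsupp.mem_support_iff, Nat.support_factorization]
    exact hp
  calc ∏ p ∈ N.primeFactors, ((freyCurve a b).minimalDiscriminantNorm ℤ).factorization p
      ≤ ∏ p ∈ N.primeFactors, 8 * m.factorization p := by
        refine Finset.prod_le_prod (fun _ _ => Nat.zero_le _) fun p hp => ?_
        have h1 := hvm p (hsub hp)
        have h2 : ((freyCurve a b).minimalDiscriminantNorm ℤ).factorization p ≤
            4 * (if 2 = p then 1 else 0) + 2 * m.factorization p :=
          factorization_minimalDiscriminantNorm_freyCurve_le_ite h0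
            (Nat.prime_of_mem_primeFactors hp)
        split_ifs at h2 <;> omega
    _ = 8 ^ N.primeFactors.card * ∏ p ∈ N.primeFactors, m.factorization p := by
        rw [Finset.prod_mul_distrib, Finset.prod_const]
    _ ≤ 8 ^ N.primeFactors.card * ∏ p ∈ m.primeFactors, m.factorization p :=
        Nat.mul_le_mul_left _
          (Finset.prod_le_prod_of_subset_of_one_le' hsub fun p hp _ => hvm p hp)
    _ = 8 ^ N.primeFactors.card * exponentProduct m := by rw [exponentProduct_def]

/-! ### Pasten's theorem for signed pairs -/

/-- **Pasten's product theorem for signed pairs, exponent `3`.** From `pasten2024_thm_2_5`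
(with `ε = 1/3`): for coprime integers `a, b` with `ab(a+b) ≠ 0`,
`∏_{p ∣ ab(a+b)} v_p(ab(a+b)) ≤ κ · rad|ab(a+b)|³` with `κ ≥ 0` — rearrange signs so that the two
of `|a|, |b|, |a+b|` adding up to the third are the `a, b` of an abc triple (as in the tree's
`log_natAbs_le_of_stewartTijdeman`). [folklore] -/
theorem exponentProduct_natAbs_le_of_pasten (hP : pasten2024_thm_2_5) :
    ∃ κ : ℝ, 0 ≤ κ ∧ ∀ a b : ℤ, IsCoprime a b → a * b * (a + b) ≠ 0 →
      (exponentProduct (a * b * (a + b)).natAbs : ℝ) ≤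
        κ * ((radical (a * b * (a + b)).natAbs : ℕ) : ℝ) ^ 3 := by
  obtain ⟨κ₀, hκ₀⟩ := hP (1 / 3) (by norm_num)
  refine ⟨max κ₀ 0, le_max_right _ _, fun a b hab h0 => ?_⟩
  -- the bound for an abc triple `(u, w, u + w)`
  have key : ∀ u w k : ℕ, 0 < u → 0 < w → u + w = k → Nat.Coprime u w →
      (exponentProduct (u * w * k) : ℝ) ≤ max κ₀ 0 * ((radical (u * w * k) : ℕ) : ℝ) ^ 3 := by
    intro u w k hu hw hk huw
    have h := hκ₀ u w k ⟨hu, hw, hk, huw⟩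
    rw [rad_def, show (8 / 3 + 1 / 3 : ℝ) = ((3 : ℕ) : ℝ) by norm_num, Real.rpow_natCast] at h
    exact h.trans (mul_le_mul_of_nonneg_right (le_max_left _ _) (by positivity))
  -- the three arrangements of signs
  have hA : a ≠ 0 := fun h => h0 (by rw [h]; ring)
  have hB : b ≠ 0 := fun h => h0 (by rw [h]; ring)
  have hD : a + b ≠ 0 := fun h => h0 (by rw [h]; ring)
  set x := a.natAbs with hx
  set y := b.natAbs with hy
  set z := (a + b).natAbs with hz
  have hx0 : 0 < x := Int.natAbs_pos.mpr hA
  have hy0 : 0 < y := Int.natAbs_pos.mpr hB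
  have hz0 : 0 < z := Int.natAbs_pos.mpr hD
  have hprod : (a * b * (a + b)).natAbs = x * y * z := by simp [hx, hy, hz, Int.natAbs_mul]
  rw [hprod]
  have cop : ∀ {M N : ℤ}, IsCoprime M N → Nat.Coprime M.natAbs N.natAbs := by
    intro M N h
    rw [Nat.Coprime, ← Int.gcd_eq_natAbs]
    exact Int.isCoprime_iff_gcd_eq_one.mp h
  have hAD : IsCoprime a (a + b) := by
    obtain ⟨u, w, huw⟩ := hab
    exact ⟨u - w, w, by linear_combination huw⟩
  have hBD : IsCoprime b (a + b) := by
    obtain ⟨u, w, huw⟩ := hab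
    exact ⟨w - u, u, by linear_combination huw⟩
  have hcases : x + y = z ∨ x + z = y ∨ y + z = x := by omega
  rcases hcases with h | h | h
  · exact key x y z hx0 hy0 h (cop hab)
  · have h1 := key x z y hx0 hz0 h (cop hAD)
    rwa [show x * z * y = x * y * z by ring] at h1
  · have h1 := key y z x hy0 hz0 h (cop hBD)
    rwa [show y * z * x = x * y * z by ring] at h1

end XiBoundExponentProduct

open Literature.NumberTheory.EllipticCurves Literature.NumberTheory.DiophantineGeometry
open UniqueFactorizationMonoid

/-- **Polynomial exponent product on Frey curves, from Pasten's theorem** (stub 4b of line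
`two-adic-redei-depth`). `pasten2024_thm_2_5 → ∏_{p ∣ N} ord_p Δ_min(E_(a,b)) ≤ C · N^A` with
`A = 6`, `C = 8 κ_{1/3}`: at every prime `p ∣ N` one has `p ∣ ab(a+b)` and
`ord_p Δ_min ≤ v_p(16 (ab(a+b))²) ≤ 8 v_p(ab(a+b))` (the Frey model is integral, and the minimal
discriminant divides the discriminant of any integral model), so
`∏_{p ∣ N} ord_p Δ_min ≤ 8^{ω(N)} ∏_{p ∣ ab(a+b)} v_p(ab(a+b)) ≤ N³ · κ · rad|ab(a+b)|³ ≤ N³ κ (2N)³`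
by Pasten's theorem with `ε = 1/3` on the abc triple made of `|a|, |b|, |a+b|` and
`rad|ab(a+b)| ∣ 2N` (`radical_natAbs_dvd_two_mul_conductorNorm_freyCurve`). [folklore] -/
theorem stub_exponentProductFreyOfPasten :
    Literature.NumberTheory.DiophantineGeometry.pasten2024_thm_2_5 →
    ∃ A C : ℝ, ∀ a b : ℤ, IsCoprime a b → a * b * (a + b) ≠ 0 → ∀ (N : ℕ) [NeZero N],
      (freyCurve a b).conductorNorm ℤ = N →
      ((∏ p ∈ N.primeFactors, ((freyCurve a b).minimalDiscriminantNorm ℤ).factorization p : ℕ) : ℝ)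
        ≤ C * (N : ℝ) ^ A := by
  intro hP
  obtain ⟨κ, hκ0, hκ⟩ := XiBoundExponentProduct.exponentProduct_natAbs_le_of_pasten hP
  refine ⟨((6 : ℕ) : ℝ), 8 * κ, fun a b hab h0 N _ hN => ?_⟩
  rw [Real.rpow_natCast]
  have hN0 : N ≠ 0 := NeZero.ne N
  set m := (a * b * (a + b)).natAbs with hm
  -- (1) the combinatorial core
  have h1 := XiBoundExponentProduct.prod_factorization_minimalDiscriminantNorm_freyCurve_le h0
  rw [hN] at h1
  have h8 := XiBoundExponentProduct.eight_pow_card_primeFactors_le hN0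
  have h1R : ((∏ p ∈ N.primeFactors, ((freyCurve a b).minimalDiscriminantNorm ℤ).factorization p
      : ℕ) : ℝ) ≤ (N : ℝ) ^ 3 * (exponentProduct m : ℝ) := by
    have h := h1.trans (Nat.mul_le_mul_right _ h8)
    exact_mod_cast h
  -- (2) Pasten on the triple, `rad ≤ 2N`
  have h2 := hκ a b hab h0
  have hrad := radical_natAbs_dvd_two_mul_conductorNorm_freyCurve hab h0
  rw [hN] at hrad
  have hR : ((radical m : ℕ) : ℝ) ≤ 2 * (N : ℝ) := by
    have := Nat.le_of_dvd (Nat.pos_of_ne_zero (mul_ne_zero two_ne_zero hN0)) hrad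
    exact_mod_cast this
  have hR0 : (0 : ℝ) ≤ ((radical m : ℕ) : ℝ) := Nat.cast_nonneg _
  have hR3 : ((radical m : ℕ) : ℝ) ^ 3 ≤ (2 * (N : ℝ)) ^ 3 := pow_le_pow_left₀ hR0 hR 3
  have hP3 : (exponentProduct m : ℝ) ≤ κ * (2 * (N : ℝ)) ^ 3 :=
    h2.trans (mul_le_mul_of_nonneg_left hR3 hκ0)
  -- assemble
  calc ((∏ p ∈ N.primeFactors, ((freyCurve a b).minimalDiscriminantNorm ℤ).factorization p
        : ℕ) : ℝ) ≤ (N : ℝ) ^ 3 * (exponentProduct m : ℝ) := h1R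
    _ ≤ (N : ℝ) ^ 3 * (κ * (2 * (N : ℝ)) ^ 3) := mul_le_mul_of_nonneg_left hP3 (by positivity)
    _ = 8 * κ * (N : ℝ) ^ 6 := by ring

end Summit.ABC.ABC.Theorems

end
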